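import Summits.Langlands.Langlands.Theses.DyadicOddResidue
import Literature.NumberTheory.Automorphic.POrdinaryHeckeAlgebraGL2
import Literature.NumberTheory.Automorphic.ReciprocityGLnQlModelProofs
import Literature.NumberTheory.GaloisRepresentations.StableLatticeValuationRing
import Literature.NumberTheory.GaloisRepresentations.PadicIntermediateFieldIntegers
import Literature.NumberTheory.GaloisRepresentations.RestrictFieldSelf
import Literature.NumberTheory.GaloisRepresentations.HeckeCharacterProofs
import Literature.NumberTheory.GaloisRepresentations.AbsolutelyIrreducibleReduction
import Literature.RepresentationTheory.Semisimple.FinTwoSemisimplification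
import Literature.NumberTheory.EllipticCurves.NewformGaloisRepModLProofs

/-!
# Stub T2 `ordinarySeedOnComponent` of crux `DyadicEisensteinFM` (stmt-Langlands-18741): the degenerate
# case "`ρ` is reducible on the decomposition group at `2`" — the CONSTANT family over `F = ℚ`
# (line `ordinary-seed-propagation`; `--supports` file, closes nothing)

Helper file for the crux `Summit.Langlands.Langlands.Theses.DyadicOddResidue.DyadicEisensteinFM`.  The
registered stub `stub_ordinarySeedOnComponent` (T2) of the checked skeleton
`Cruxes/DyadicEisensteinFM/Lines/ordinary_seed_propagation.lean` asks, for `ρ` with the crux hypotheses and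
irreducible over every quadratic field, for a totally real `F` and an odd Eisenstein `2`-adic `F`-family
`(A, D)` through `ρ|_{Γ_F}` carrying an ORDINARY SEED `ρ₀`.  Its content is the NON-ordinary half; this file
proves the ORDINARY half — T2 verbatim with ONE extra antecedent "`ρ|_{Γ_{ℚ_v}}` is conjugate into the Borel
for `v ∣ 2`" — and certifies that every clause of the family vocabulary COMPUTES from the crux hypotheses:
`F := ℚ`; `A := 𝒪_E` for a finite `E/ℚ₂ ⊆ ℚ̄₂` carrying a model of `ρ` (the tree's PROVED
`exists_hasQlModel_holds`), compact Hausdorff, a discrete valuation ring (`PadicIntermediateFieldIntegers`);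
`D := (tr ρ_A, det ρ_A)` for an integral model `ρ_A : Γ_ℚ → GL₂(𝒪_E)`
(`exists_integralModel_of_valuationSubring`); `x₀ = x₂ := (𝒪_E ⊆ ℚ̄₂)`; `ρ₀ := ρ`.  `Continuous D.trace`
⟸ continuity of `tr ρ` (`𝒪_E → ℚ̄₂` is an embedding); finite ramification ⟸ `hunr` (`GL₂` of an injection
is injective, the tree's `generalLinearGroup_map_injective_of_injective`); `det D(c) = -1` ⟸ `hodd`;
`D` residually `χ₁ ⊕ χ₂` ⟸ `hres` (the reduction of `ρ_A ⊗ ℤ̄₂`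
IS a reduction of `ρ` in the sense of `IsReductionOf`, hence not absolutely irreducible, and a reducible
plane representation over a field has `tr = χ₁ + χ₂`, `det = χ₁χ₂`, §1–§2); the point clauses ⟸
`tr(P⁻¹ρP) = tr ρ` and `ρ.restrictField ℚ = ρ(σ₀) ρ ρ(σ₀)⁻¹` (`exists_restrictField_self_eq_conj`); the seed
clauses for `ρ₀ = ρ` are `hirr`, `hodd`, `hunr`, `hnCM` (along `Subsingleton (Algebra ℚ K)`) and the extra
antecedent.  No definitions, no named facts; what remains OPEN of T2 is exactly its non-ordinary half.
-/
set_option linter.dupNamespace false -- project-wide option; `Summit.Langlands.Langlands` is the mandated namespace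

noncomputable section

namespace Summit.Langlands.Langlands.Theorems.DyadicEisensteinFM

open Literature.NumberTheory.Automorphic Literature.NumberTheory.GaloisRepresentations
open Literature.NumberTheory.PAdicHodge
open scoped MatrixGroups Matrix
open NumberField IsDedekindDomain Filter Field

/-! ## §1 A reducible plane representation over a field is a sum of two characters on traces -/

section TwoByTwo

variable {k : Type*} [Field k] {G : Type*} [Group G]

/-- **A reducible `ψ : G → GL₂(k)` has `tr ψ = χ₁ + χ₂` and `det ψ = χ₁ χ₂`** for two characters
`χ₁, χ₂ : G → kˣ`: if the representation of `G` on `k²` through `ψ` is not irreducible there is a stable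
line `k w`; `χ₁` is its eigen-character, `χ₂ = det ψ · χ₁⁻¹`, and `χ₁(g)` is a root of
`X² − tr ψ(g) X + det ψ(g)` (Cayley–Hamilton), whence `tr ψ(g) = χ₁(g) + det ψ(g)/χ₁(g)`.  Same argument
as the tree's `Literature.RepresentationTheory.Semisimple.exists_semisimplification_fin_two`
(Curtis–Reiner I §16B). [folklore] -/
theorem exists_characters_trace_det_of_not_isIrreducible (ψ : G →* GL (Fin 2) k)
    (hirr : ¬ (glRepresentation ψ).IsIrreducible) :
    ∃ χ₁ χ₂ : G →* kˣ, ∀ g,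
      ((ψ g : GL (Fin 2) k) : Matrix (Fin 2) (Fin 2) k).trace = χ₁ g + χ₂ g ∧
      ((ψ g : GL (Fin 2) k) : Matrix (Fin 2) (Fin 2) k).det = χ₁ g * χ₂ g := by
  classical
  set R := glRepresentation ψ with hR
  have hRapply : ∀ (g : G) (v : Fin 2 → k),
      R g v = ((ψ g : GL (Fin 2) k) : Matrix (Fin 2) (Fin 2) k) *ᵥ v := fun _ _ ↦ rfl
  -- a stable line `k w`
  have hbt : (⊥ : Subrepresentation R) ≠ ⊤ := fun h ↦
    bot_ne_top (congrArg Subrepresentation.toSubmodule h : (⊥ : Submodule k (Fin 2 → k)) = ⊤)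
  obtain ⟨W, hW0, hW1⟩ : ∃ W : Subrepresentation R, W ≠ ⊥ ∧ W ≠ ⊤ := by
    by_contra hcon
    push Not at hcon
    haveI : Nontrivial (Subrepresentation R) := ⟨⟨⊥, ⊤, hbt⟩⟩
    exact hirr ⟨fun W ↦ or_iff_not_imp_left.mpr (hcon W)⟩
  have hW0' : W.toSubmodule ≠ ⊥ := fun h ↦
    hW0 (Subrepresentation.toSubmodule_injective (h : _ = (⊥ : Subrepresentation R).toSubmodule))
  have hW1' : W.toSubmodule ≠ ⊤ := fun h ↦
    hW1 (Subrepresentation.toSubmodule_injective (h : _ = (⊤ : Subrepresentation R).toSubmodule))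
  have hWrank : Module.finrank k W.toSubmodule = 1 :=
    Literature.RepresentationTheory.Semisimple.finrank_eq_one_of_ne_bot_of_ne_top hW0' hW1'
  obtain ⟨w, hwW, hw0⟩ := Submodule.exists_mem_ne_zero_of_ne_bot hW0'
  have hmult : ∀ v ∈ W.toSubmodule, ∃ c : k, c • w = v := by
    intro v hv
    obtain ⟨c, hc⟩ := (finrank_eq_one_iff_of_nonzero' (⟨w, hwW⟩ : W.toSubmodule)
      (by exact_mod_cast Subtype.coe_ne_coe.mp hw0 : (⟨w, hwW⟩ : W.toSubmodule) ≠ 0)).mp hWrank ⟨v, hv⟩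
    exact ⟨c, by simpa using congrArg Subtype.val hc⟩
  have hex : ∀ g : G, ∃ c : k, c • w = R g w := fun g ↦ hmult _ (W.apply_mem_toSubmodule g hwW)
  choose χ hχ using hex
  have hχne : ∀ g, χ g ≠ 0 := by
    intro g hg
    have h1 : R g w = 0 := by rw [← hχ g, hg, zero_smul]
    have h2 : w = 0 := by
      have := congrArg (R g⁻¹) h1
      rwa [map_zero, ← Module.End.mul_apply, ← map_mul, inv_mul_cancel, map_one,
        Module.End.one_apply] at this
    exact hw0 h2
  have hχmul : ∀ g h, χ (g * h) = χ g * χ h := by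
    intro g h
    apply smul_left_injective k hw0
    change χ (g * h) • w = (χ g * χ h) • w
    rw [hχ, map_mul, Module.End.mul_apply, ← hχ h, map_smul, ← hχ g, smul_smul, mul_comm]
  have hχone : χ 1 = 1 := by
    apply smul_left_injective k hw0
    change χ 1 • w = (1 : k) • w
    rw [hχ, map_one, Module.End.one_apply, one_smul]
  let χ₁ : G →* kˣ :=
    { toFun := fun g ↦ Units.mk0 (χ g) (hχne g)
      map_one' := Units.ext hχone
      map_mul' := fun g h ↦ Units.ext (hχmul g h) }
  have hχ₁ : ∀ g, ((χ₁ g : kˣ) : k) = χ g := fun _ ↦ rfl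
  let δ : G →* kˣ := Matrix.GeneralLinearGroup.det.comp ψ
  have hδ : ∀ g, ((δ g : kˣ) : k) = ((ψ g : GL (Fin 2) k) : Matrix (Fin 2) (Fin 2) k).det :=
    fun _ ↦ rfl
  let χ₂ : G →* kˣ := δ * χ₁⁻¹
  have hχ₂ : ∀ g, ((χ₂ g : kˣ) : k) =
      ((ψ g : GL (Fin 2) k) : Matrix (Fin 2) (Fin 2) k).det * (χ g)⁻¹ :=
    fun g ↦ by simp [χ₂, hδ, hχ₁]
  have hroot : ∀ g, χ g ^ 2 - ((ψ g : GL (Fin 2) k) : Matrix (Fin 2) (Fin 2) k).trace * χ g +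
      ((ψ g : GL (Fin 2) k) : Matrix (Fin 2) (Fin 2) k).det = 0 := fun g ↦
    Literature.RepresentationTheory.Semisimple.sq_sub_trace_mul_add_det_eq_zero hw0
      (by rw [← hRapply, ← hχ g])
  refine ⟨χ₁, χ₂, fun g ↦ ⟨?_, ?_⟩⟩
  · rw [hχ₁, hχ₂]
    have hinv : χ g * (χ g)⁻¹ = 1 := mul_inv_cancel₀ (hχne g)
    linear_combination -(χ g)⁻¹ * hroot g +
      (χ g - ((ψ g : GL (Fin 2) k) : Matrix (Fin 2) (Fin 2) k).trace) * hinv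
  · rw [hχ₁, hχ₂, ← mul_assoc, mul_comm (χ g), mul_assoc, mul_inv_cancel₀ (hχne g), mul_one]

end TwoByTwo

/-! ## §2 The residual clause of a constant family from `¬ IsResiduallyAbsIrreducible` -/

section Residual

variable {K : Type*} [Field K] {ℓ : ℕ} [Fact ℓ.Prime] {A : Type*} [CommRing A] [IsLocalRing A]

/-- **The determinant of an integral model of a residually-not-absolutely-irreducible `ρ` is residually
a sum of two characters.**  Let `ρ : Γ_K → GL₂(ℚ̄_ℓ)`, `A` a local ring with a LOCAL homomorphism
`j : A → ℤ̄_ℓ`, and `ρ_A : Γ_K → GL₂(A)` with `(j ∘ ρ_A) = P⁻¹ ρ P` in `GL₂(ℚ̄_ℓ)`.  Then `j ∘ ρ_A` is an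
integral model of `ρ` over `ℤ̄_ℓ` (`IsIntegralModelOf`, frame `P`) and its reduction `τ` is a reduction
of `ρ` (`IsReductionOf`, `Q = 1`); if `ρ` is not residually absolutely irreducible, `τ ⊗_f k` is reducible
for some field `k` and `f : ℤ̄_ℓ/𝔪 → k`, so by `exists_characters_trace_det_of_not_isIrreducible`
`(D_A mod 𝔪_A) ⊗_i k = χ₁ ⊕ χ₂` for `D_A = (tr ρ_A, det ρ_A)` and `i = f ∘ (A/𝔪_A → ℤ̄_ℓ/𝔪)`.
[folklore] -/
theorem exists_map_residue_ofRep_eq_ofCharacters (ρ : FramedGaloisRep K (PadicAlgCl ℓ) 2)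
    (hres : ¬ ρ.IsResiduallyAbsIrreducible) (ρA : absoluteGaloisGroup K →* GL (Fin 2) A)
    (j : A →+* padicAlgClIntegers ℓ) [IsLocalHom j] (P : GL (Fin 2) (PadicAlgCl ℓ))
    (hmodel : ∀ g, Matrix.GeneralLinearGroup.map ((padicAlgClIntegers ℓ).subtype.comp j) (ρA g) =
      P⁻¹ * ρ g * P) :
    ∃ (k : Type) (_ : Field k) (i : IsLocalRing.ResidueField A →+* k)
      (χ₁ χ₂ : absoluteGaloisGroup K →* kˣ),
      ((PseudoRep2.ofRep ρA).map (IsLocalRing.residue A)).map i = PseudoRep2.ofCharacters χ₁ χ₂ := by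
  set ρZ : absoluteGaloisGroup K →* GL (Fin 2) (padicAlgClIntegers ℓ) :=
    (Matrix.GeneralLinearGroup.map j).comp ρA with hρZ
  have hint : IsIntegralModelOf (ρ : absoluteGaloisGroup K →* GL (Fin 2) (PadicAlgCl ℓ)) ρZ :=
    ⟨P, fun g => hmodel g⟩
  set τ := integralReduction (RingHom.id _) ρZ with hτ
  have hred : ρ.IsReductionOf (RingHom.id _) τ := ⟨ρZ, 1, hint, fun g => by simp [hτ]⟩
  have hnot : ¬ IsAbsIrreducible τ := fun h => hres ⟨τ, hred, h⟩
  unfold IsAbsIrreducible at hnot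
  push Not at hnot
  obtain ⟨k, _, f, hk⟩ := hnot
  obtain ⟨χ₁, χ₂, hχ⟩ := exists_characters_trace_det_of_not_isIrreducible _ hk
  refine ⟨k, inferInstance, f.comp (IsLocalRing.ResidueField.map j), χ₁, χ₂, ?_⟩
  have hentry : ∀ (g : absoluteGaloisGroup K) (a b : Fin 2),
      (((Matrix.GeneralLinearGroup.map f).comp τ g : GL (Fin 2) k) : Matrix (Fin 2) (Fin 2) k) a b =
        f (IsLocalRing.ResidueField.map j (IsLocalRing.residue A ((ρA g).val a b))) := by
    intro g a b
    rw [IsLocalRing.ResidueField.map_residue]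
    rfl
  refine PseudoRep2.ext (funext fun g => ?_) (MonoidHom.ext fun g => Units.ext ?_)
  · have h := (hχ g).1
    rw [Matrix.trace_fin_two, hentry, hentry] at h
    simp only [PseudoRep2.map_trace, PseudoRep2.ofRep_trace, PseudoRep2.ofCharacters_trace,
      Matrix.trace_fin_two, map_add, RingHom.comp_apply]
    exact h
  · have h := (hχ g).2
    rw [Matrix.det_fin_two, hentry, hentry, hentry, hentry] at h
    simp only [PseudoRep2.map_det, PseudoRep2.ofRep_det, PseudoRep2.ofCharacters_det,
      Matrix.det_fin_two, map_sub, map_mul, RingHom.comp_apply, Units.val_mul]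
    exact h

end Residual

/-! ## §3 Small transports: restriction along `ℚ = ℚ` -/

section Transport

variable {A : Type*} [Field A] [TopologicalSpace A] [IsTopologicalRing A] {n : ℕ}

/-- **Restriction along `ℚ = ℚ` preserves irreducibility**, for ANY `ℚ`-algebra structure on `ℚ`
(`Subsingleton (Algebra ℚ ℚ)`; the crux's `F := ℚ` instantiates `DivisionRing.toRatAlgebra`):
`absGaloisRestrict ℚ ℚ` is an inner automorphism (`exists_absGaloisRestrict_self_eq_conj`), in particular
surjective, so `ρ ∘ res` and `ρ` have the same stable subspaces. [folklore] -/
theorem isIrreducible_restrictField_rat [inst : Algebra ℚ ℚ] (ρ : FramedGaloisRep ℚ A n)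
    (h : ρ.toGaloisRep.IsIrreducible) : (ρ.restrictField ℚ).toGaloisRep.IsIrreducible := by
  have hi : inst = Algebra.id ℚ := Subsingleton.elim _ _
  subst hi
  obtain ⟨σ₀, hσ₀⟩ := exists_absGaloisRestrict_self_eq_conj (K := ℚ)
  have hsurj : Function.Surjective (absGaloisRestrict ℚ ℚ) := fun τ =>
    ⟨σ₀ * τ * σ₀⁻¹, by rw [hσ₀]; group⟩
  haveI : Representation.IsIrreducible ρ.toGaloisRep.toRepresentation := h
  let e : Subrepresentation (ρ.restrictField ℚ).toGaloisRep.toRepresentation ≃o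
      Subrepresentation ρ.toGaloisRep.toRepresentation :=
    { toFun := fun W => ⟨W.toSubmodule, fun g v hv => by
        obtain ⟨g', rfl⟩ := hsurj g
        exact W.apply_mem_toSubmodule g' hv⟩
      invFun := fun W => ⟨W.toSubmodule, fun g' v hv =>
        W.apply_mem_toSubmodule (absGaloisRestrict ℚ ℚ g') hv⟩
      left_inv := fun _ => rfl
      right_inv := fun _ => rfl
      map_rel_iff' := Iff.rfl }
  exact e.isSimpleOrder_iff.2 ‹_›

/-- `tr (ρ|_{Γ_ℚ} σ) = tr ρ(σ)` for the restriction along `ℚ = ℚ` (a change of frame,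
`FramedGaloisRep.exists_restrictField_self_eq_conj`), for ANY `ℚ`-algebra structure on `ℚ`. [folklore] -/
theorem trace_restrictField_rat [inst : Algebra ℚ ℚ] (ρ : FramedGaloisRep ℚ A n)
    (σ : absoluteGaloisGroup ℚ) :
    ((ρ.restrictField ℚ σ : GL (Fin n) A) : Matrix (Fin n) (Fin n) A).trace =
      ((ρ σ : GL (Fin n) A) : Matrix (Fin n) (Fin n) A).trace := by
  have hi : inst = Algebra.id ℚ := Subsingleton.elim _ _
  subst hi
  obtain ⟨σ₀, hσ₀⟩ := ρ.exists_restrictField_self_eq_conj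
  rw [hσ₀, FramedRep.conj_apply, Units.val_mul, Units.val_mul, Matrix.trace_units_conj]

end Transport

/-! ## §4 The degenerate case of stub T2: the constant `𝒪_E`-family over `F = ℚ` -/

/-- **Stub T2 `ordinarySeedOnComponent`, ORDINARY (locally reducible at `2`) case — the constant family.**
VERBATIM the registered stub `stub_ordinarySeedOnComponent` of `Cruxes/DyadicEisensteinFM/Lines/
ordinary_seed_propagation.lean` (crux hypotheses `hres hirr hodd hunr hdR hnCM`; conclusion: a totally real
Galois `F`, `2 ∤ d_F`, `N w = 2` for `w ∣ 2`, `ρ|_{Γ_F}` irreducible, and an odd Eisenstein `2`-adic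
`F`-family `(A, D, x₀, x₂)` through `ρ|_{Γ_F}` with an ordinary seed `ρ₀`) with ONE extra antecedent
inserted last: `ρ|_{Γ_{ℚ_v}}` is conjugate into the Borel for the place `v ∣ 2`.  Witnesses `F := ℚ`,
`A := 𝒪_E` (`E/ℚ₂` finite carrying a model of `ρ`, `exists_hasQlModel_holds`), `D := (tr ρ_A, det ρ_A)` for
an integral model `ρ_A` (`exists_integralModel_of_valuationSubring`), `x₀ = x₂ := (𝒪_E ⊆ ℚ̄₂)`, `ρ₀ := ρ`;
the family clauses are computed from `hunr`, `hodd`, `hres` (`exists_map_residue_ofRep_eq_ofCharacters`) and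
the continuity of `tr ρ`, the seed clauses are the hypotheses themselves.  So T2 holds for every `ρ` of the
crux that is reducible at `2`; its open content is the non-ordinary half. [folklore] -/
theorem ordinarySeedOnComponent_of_locallyReducible :
  ∀ (ρ : FramedGaloisRep ℚ (PadicAlgCl 2) 2),
    ¬ ρ.IsResiduallyAbsIrreducible → ρ.toGaloisRep.IsIrreducible → ρ.IsOdd →
    (∀ᶠ v : HeightOneSpectrum (𝓞 ℚ) in cofinite, ρ.IsUnramifiedAt v) →
    (∀ (v : HeightOneSpectrum (𝓞 ℚ)) (hv : ((2 : ℕ) : 𝓞 ℚ) ∈ v.asIdeal),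
      (fontainePstAdicCompletion v 2 hv).IsDeRhamFramed (ρ.toLocal v) ∧
      ∀ τ : v.adicCompletion ℚ →+* PadicAlgCl 2, Continuous τ →
        (ρ.labelledHodgeTateWeightsAt v (fontainePstAdicCompletion v 2 hv).algebra
          (fontainePstAdicCompletion v 2 hv).𝔅 τ).Nodup) →
    (∀ (K : Type) [Field K] [NumberField K], Module.finrank ℚ K = 2 →
      (ρ.restrictField K).toGaloisRep.IsIrreducible) →
    (∀ (v : HeightOneSpectrum (𝓞 ℚ)), ((2 : ℕ) : 𝓞 ℚ) ∈ v.asIdeal →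
      ∃ Q : GL (Fin 2) (PadicAlgCl 2), ∀ σ : absoluteGaloisGroup (v.adicCompletion ℚ),
        (Q⁻¹ * ρ.toLocal v σ * Q).val 1 0 = 0) →
    ∃ (F : Type) (_ : Field F) (_ : NumberField F), IsTotallyReal F ∧ IsGalois ℚ F ∧
      ¬ ((2 : ℤ) ∣ NumberField.discr F) ∧
      (∀ w : HeightOneSpectrum (𝓞 F), ((2 : ℕ) : 𝓞 F) ∈ w.asIdeal → w.residueCard = 2) ∧
      (ρ.restrictField F).toGaloisRep.IsIrreducible ∧
      ∃ (A : Type) (_ : CommRing A) (_ : IsDomain A) (_ : IsNoetherianRing A) (_ : IsLocalRing A)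
        (_ : TopologicalSpace A) (_ : IsTopologicalRing A) (_ : CompactSpace A) (_ : T2Space A)
        (D : PseudoRep2 (absoluteGaloisGroup F) A) (x₀ x₂ : A →+* PadicAlgCl 2)
        (ρ₀ : FramedGaloisRep F (PadicAlgCl 2) 2),
        (Continuous D.trace ∧
          (∃ S : Set (HeightOneSpectrum (𝓞 F)), S.Finite ∧ ∀ v ∉ S, ∀ 𝔓 ∈ v.primesAbove,
            ∀ σ ∈ 𝔓.inertia (absoluteGaloisGroup F), D.det σ = 1 ∧
              ∀ τ : absoluteGaloisGroup F, D.trace (τ * σ) = D.trace τ) ∧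
          (∀ (φ : F →+* ℝ) (c : absoluteGaloisGroup F), IsComplexConjugation φ c →
            ((D.det c : Aˣ) : A) = -1) ∧
          (∃ (k : Type) (_ : Field k) (i : IsLocalRing.ResidueField A →+* k)
            (χ₁ χ₂ : absoluteGaloisGroup F →* kˣ),
            (D.map (IsLocalRing.residue A)).map i = PseudoRep2.ofCharacters χ₁ χ₂)) ∧
        (Continuous x₀ ∧ Continuous x₂ ∧ (∀ σ, x₀ (D.trace σ) = (ρ₀ σ).val.trace) ∧
          (∀ σ, x₂ (D.trace σ) = ((ρ.restrictField F) σ).val.trace)) ∧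
        (ρ₀.toGaloisRep.IsIrreducible ∧ ρ₀.IsOdd ∧
          (∀ᶠ w : HeightOneSpectrum (𝓞 F) in cofinite, ρ₀.IsUnramifiedAt w) ∧
          (∀ (K : Type) [Field K] [NumberField K] [Algebra F K], Module.finrank F K = 2 →
            (ρ₀.restrictField K).toGaloisRep.IsIrreducible) ∧
          ∀ w : HeightOneSpectrum (𝓞 F), ((2 : ℕ) : 𝓞 F) ∈ w.asIdeal →
            ∃ Q : GL (Fin 2) (PadicAlgCl 2), ∀ σ : absoluteGaloisGroup (w.adicCompletion F),
              (Q⁻¹ * ρ₀.toLocal w σ * Q).val 1 0 = 0) := by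
  intro ρ hres hirr hodd hunr _hdR hnCM hBorel
  -- a model over a finite `E/ℚ₂` (Baire) and a stable `𝒪_E`-lattice (compactness of `Γ_ℚ`)
  obtain ⟨E, rE, hfin, P₀, hP₀⟩ := exists_hasQlModel_holds ρ
  haveI := hfin
  set O := intermediateFieldIntegers 2 E with hOdef
  have hO : IsOpen ((O : ValuationSubring E) : Set E) := by
    have : ((O : ValuationSubring E) : Set E) = Metric.closedBall (0 : E) 1 := by
      ext x
      rw [SetLike.mem_coe, hOdef, intermediateFieldIntegers.mem_iff_norm_le_one,
        Metric.mem_closedBall, dist_zero_right]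
    rw [this]
    exact IsUltrametricDist.isOpen_closedBall _ one_ne_zero
  obtain ⟨P₁, ρA, hρA⟩ := exists_integralModel_of_valuationSubring
    (O := O) (G := absoluteGaloisGroup ℚ) hO rE
  -- the inclusion `𝒪_E ⊆ ℚ̄₂` and its factorisation through `ℤ̄₂` (a local homomorphism)
  set jOQ : O →+* PadicAlgCl 2 := (algebraMap E (PadicAlgCl 2)).comp O.subtype with hjOQ
  have hjOQ_inj : Function.Injective jOQ := Subtype.val_injective.comp Subtype.val_injective
  have hjOQ_cont : Continuous jOQ := continuous_subtype_val.comp continuous_subtype_val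
  have hjOQ_mem : ∀ x : O, jOQ x ∈ padicAlgClIntegers 2 := fun x =>
    (padicAlgCl_mem_valuationSubring_iff 2 _).2 (intermediateFieldIntegers.norm_le_one E x)
  set j : O →+* padicAlgClIntegers 2 := jOQ.codRestrict (padicAlgClIntegers 2) hjOQ_mem with hj
  haveI : IsLocalHom j := by
    refine ⟨fun a ha => (intermediateFieldIntegers.isUnit_iff_norm_eq_one E a).2
      (le_antisymm (intermediateFieldIntegers.norm_le_one E a) (not_lt.mp fun hlt => ?_))⟩
    have hmem : j a ∈ IsLocalRing.maximalIdeal (padicAlgClIntegers 2) := by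
      rw [mem_maximalIdeal_iff_norm_lt_one (padicAlgCl_mem_valuationSubring_iff 2)]
      exact hlt
    exact (IsLocalRing.mem_maximalIdeal _ |>.mp hmem) ha
  -- the combined frame: `jOQ ∘ ρ_A = P⁻¹ ρ P`
  set P : GL (Fin 2) (PadicAlgCl 2) :=
    P₀ * Matrix.GeneralLinearGroup.map (algebraMap E (PadicAlgCl 2)) P₁ with hP
  have hmodel : ∀ g, Matrix.GeneralLinearGroup.map jOQ (ρA g) = P⁻¹ * ρ g * P := by
    intro g
    have h1 : ρ g =
        P₀ * Matrix.GeneralLinearGroup.map (algebraMap E (PadicAlgCl 2)) (rE g) * P₀⁻¹ := by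
      rw [← hP₀]; rfl
    rw [hjOQ, Matrix.GeneralLinearGroup.map_comp, MonoidHom.comp_apply, hρA g, map_mul, map_mul,
      map_inv, h1, hP]
    group
  -- trace, determinant and kernel of `ρ_A` read in `ℚ̄₂`
  have htrace : ∀ g, jOQ ((ρA g : GL (Fin 2) O) : Matrix (Fin 2) (Fin 2) O).trace =
      ((ρ g : GL (Fin 2) (PadicAlgCl 2)) : Matrix (Fin 2) (Fin 2) (PadicAlgCl 2)).trace := by
    intro g
    have h := congrArg (fun M : GL (Fin 2) (PadicAlgCl 2) =>
      (M : Matrix (Fin 2) (Fin 2) (PadicAlgCl 2)).trace) (hmodel g)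
    simp only [Units.val_mul, Matrix.trace_units_conj'] at h
    rw [← h, Matrix.trace_fin_two, Matrix.trace_fin_two, map_add]
    rfl
  have hρA_one : ∀ g, ρ g = 1 → ρA g = 1 := by
    intro g hg
    apply Literature.NumberTheory.EllipticCurves.ModularForms.DeligneSerre1974.generalLinearGroup_map_injective_of_injective
      jOQ hjOQ_inj
    rw [hmodel g, hg, map_one]
    group
  have hdet : ∀ g, jOQ (Matrix.GeneralLinearGroup.det (ρA g) : O) =
      (Matrix.GeneralLinearGroup.det (ρ g) : PadicAlgCl 2) := by
    intro g
    have h := congrArg (fun M : GL (Fin 2) (PadicAlgCl 2) =>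
      (Matrix.GeneralLinearGroup.det M : PadicAlgCl 2)) (hmodel g)
    simp only [map_mul, map_inv, Matrix.GeneralLinearGroup.map_det, Units.coe_map,
      MonoidHom.coe_coe] at h
    rw [h, inv_mul_cancel_comm]
  refine ⟨ℚ, inferInstance, inferInstance, inferInstance, IsGalois.self ℚ, ?_, ?_,
    isIrreducible_restrictField_rat (inst := _) ρ hirr, O, inferInstance, inferInstance,
    inferInstance, inferInstance, inferInstance, inferInstance,
    isCompact_iff_compactSpace.mp (intermediateFieldIntegers.isCompact_setOf_norm_le_one E),
    inferInstance, PseudoRep2.ofRep ρA, jOQ, jOQ, ρ, ⟨?_, ?_, ?_, ?_⟩,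
    ⟨hjOQ_cont, hjOQ_cont, fun σ => htrace σ, ?_⟩, ⟨hirr, hodd, hunr, ?_, hBorel⟩⟩
  · -- `2 ∤ discr ℚ = 1`
    rw [NumberField.discr_rat]; decide
  · -- `N w = 2` for the place `w ∣ 2` of `ℚ`
    intro w hw
    rw [Rat.residueCard_eq_natGenerator]
    exact (Nat.prime_dvd_prime_iff_eq (Rat.HeightOneSpectrum.prime_natGenerator w)
      Nat.prime_two).1 ((Rat.natCast_mem_asIdeal_iff w).1 hw)
  · -- continuity of the trace (`𝒪_E → ℚ̄₂` is an embedding and `jOQ ∘ tr ρ_A = tr ρ`)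
    have hemb : Topology.IsInducing jOQ :=
      Topology.IsInducing.subtypeVal.comp Topology.IsInducing.subtypeVal
    rw [hemb.continuous_iff]
    have : (jOQ ∘ (PseudoRep2.ofRep ρA).trace) = FramedRep.trace ρ := funext fun g => htrace g
    rw [this]
    exact FramedRep.continuous_trace ρ
  · -- finite ramification: `ρ_A(σ) = 1` on inertia off the ramified set
    refine ⟨{v | ¬ ρ.IsUnramifiedAt v}, Filter.eventually_cofinite.mp hunr, fun v hv 𝔓 h𝔓 σ hσ => ?_⟩
    have hv' : ρ.IsUnramifiedAt v := not_not.mp hv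
    have h1 : ρA σ = 1 := hρA_one σ (hv' 𝔓 h𝔓 σ hσ)
    refine ⟨?_, fun τ => ?_⟩
    · show Matrix.GeneralLinearGroup.det.comp ρA σ = 1
      rw [MonoidHom.comp_apply, h1, map_one]
    · show ((ρA (τ * σ) : GL (Fin 2) O) : Matrix (Fin 2) (Fin 2) O).trace =
        ((ρA τ : GL (Fin 2) O) : Matrix (Fin 2) (Fin 2) O).trace
      rw [map_mul, h1, mul_one]
  · -- total oddness in `A`: `det ρ_A(c) = -1` since `jOQ` is injective and `det ρ(c) = -1`
    intro φ c hc
    apply hjOQ_inj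
    rw [PseudoRep2.ofRep_det, ← Matrix.GeneralLinearGroup.val_det_apply, hdet c, hodd φ c hc,
      map_neg, map_one, Units.val_neg, Units.val_one]
  · -- residually a sum of two characters, from `hres`
    exact exists_map_residue_ofRep_eq_ofCharacters ρ hres ρA j P hmodel
  · -- the point `x₂` is `ρ|_{Γ_ℚ}` (restriction along `ℚ = ℚ` is a change of frame)
    intro σ
    rw [PseudoRep2.ofRep_trace, htrace σ]
    exact (trace_restrictField_rat (inst := _) ρ σ).symm
  · -- the seed `ρ₀ = ρ` stays irreducible over every quadratic `K/ℚ` (`hnCM`, any `ℚ`-algebra instance)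
    intro K _ _ inst hK
    have hinst : inst = DivisionRing.toRatAlgebra := Subsingleton.elim _ _
    subst hinst
    exact hnCM K hK

end Summit.Langlands.Langlands.Theorems.DyadicEisensteinFM
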